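import Summits.NavierStokesRegularity.NavierStokesRegularity.Theorems.ExtremiserTransienceNearExtremalTransiencePerFlowPorosityCalculus
import Summits.NavierStokesRegularity.NavierStokesRegularity.Theorems.ExtremiserTransienceNearExtremalTransiencePerFlowStubEfficiencyContinuous
import Summits.NavierStokesRegularity.NavierStokesRegularity.Theorems.ExtremiserTransienceNearExtremalTransienceDSSPerFlowAnalytic
import Summits.NavierStokesRegularity.NavierStokesRegularity.Theorems.ExtremiserTransienceKStarAttainedHalfSpaceVariation
import Summits.NavierStokesRegularity.NavierStokesRegularity.Theses.ExtremiserTransience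
import HarnessLib

/-!
# Crux `NearExtremalTransiencePerFlow` (stmt-NavierStokesRegularity-26567), LINE g7-β «zone transversality»:
# the REPAIR CENSUS of stub Z2 `stub_zoneLipschitz`, of record in the kernel

`--supports stmt-NavierStokesRegularity-26567` (helper; prover seat ns-net-p1 g6).  The registered skeleton
`Cruxes/NearExtremalTransiencePerFlow/Lines/zone_transversality.lean` composes Z1 (sojourn bound, OPEN HEART) → Z2 (two-sided zone
log-Lipschitz bound on the minimal coefficient `k₀`) → Z3 (continuity, LANDED p661994) → Z4 (zone calculus, LANDED p660552) → crux.
Z2 is crux-sized (verdict of record `Cruxes/NearExtremalTransiencePerFlow/ZoneTransversalityZ2Verdict.md`, seven prover looks: it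
contains the pointwise upper scale lock `Ξ = Z/(ν(T−t)P) ≤ C` and the palinstrophy dissipation number `Π = ν(T−t)‖Δω‖²/P` on the
near-extremal zone).  This file records, as sorry-free implications BY NAME, exactly how much of Z2 the composition consumes:

* `nearExtremalTransiencePerFlow_of_porousZone` — the crux follows from UNIFORM LOG-POROSITY of the near-extremal time set alone
  (Z1\*: every late time `s` is followed within log-time `W` by a closed interval of log-length `≥ ρ` on which `k₀ ≤ κ⋆ − ε`), via the
  landed continuity Z3 (`stub_efficiencyContinuous`) and porosity calculus Z4\* (`logMean_le_of_porousZone`, p662762).  This is the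
  line's repair R2 (Z1\* → Z3 → Z4\*) made a tree theorem; Z2 is not needed at all.
* `exists_porous_interval_of_sojourn_of_descent` (pure real analysis, first-passage argument) and
  `porousZone_of_sojournBound_of_zoneDescent` — the registered Z1 together with the ONE-SIDED DESCENT half Z2⁻ of Z2
  («`k₀ s − k₀ t ≤ Λ·log((T−s)/(T−t))` on zone windows», i.e. the efficiency cannot DROP fast inside the zone) already give Z1\*;
  hence `nearExtremalTransiencePerFlow_of_sojournBound_of_zoneDescent` : Z1 ∧ Z2⁻ ⇒ crux, and a fortiori
  `nearExtremalTransiencePerFlow_of_sojournBound_of_zoneLipschitz` : Z1 ∧ Z2 ⇒ crux (the registered line, with Z3/Z4 discharged).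
  The descent half is the cheaper one: by the verdict's bookkeeping it needs the upper lock `Ξ` (and the landed higher Type-I rates)
  but NOT `Π`, which only enters «the efficiency cannot RISE fast».

Vocabulary `IsViolator`, `IsMinimalCoeff`, `PFC` = `Theorems/ExtremiserTransienceZoneTransversalityDefs.lean` (verbatim §0 of the skeleton);
all hypotheses are stated unfolded (no new definitions).  HONEST FRAMING: implications between OPEN statements about hypothetical
Type-I singular flows and the crux; Z1, Z1\*, Z2⁻ remain OPEN; nothing about Navier–Stokes regularity or blow-up is proved; no summit
is proved by a line. [folklore]
-/

noncomputable section

open scoped Topology InnerProductSpace RealInnerProductSpace ENNReal ContDiff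
open MeasureTheory Filter Set Metric
open Literature.Analysis.FluidPDE
open Summit.NavierStokesRegularity.NavierStokesRegularity.Theses.ExtremiserTransience
open Summit.NavierStokesRegularity.NavierStokesRegularity.Theorems
open Summit.NavierStokesRegularity.NavierStokesRegularity.Theorems.DepletionLadder.KStar.HalfSpace

namespace Summit.NavierStokesRegularity.NavierStokesRegularity.Theorems.NearExtremalTransiencePerFlow.ZoneTransversality

-- the summit's namespace `Summit.NavierStokesRegularity.NavierStokesRegularity` repeats the problem name by convention (D-0017)
set_option linter.dupNamespace false

/-! ## §1 Pure real analysis: sojourn bound + one-sided descent bound ⇒ uniform log-porosity -/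

/-- **First-passage porosity lemma** (pure real analysis).  Let `k` be continuous on `[t₁,T)`; suppose every closed interval
`[s,t] ⊂ [t₁,T)` spent in the zone `{κs − ε ≤ k}` has log-length `log((T−s)/(T−t)) ≤ L` (SOJOURN BOUND) and on every such interval
`k s − k t ≤ Λ·log((T−s)/(T−t))` (ONE-SIDED DESCENT BOUND: `k` cannot drop fast inside the zone).  Then the half-zone is uniformly
log-porous: every `s ∈ [t₁,T)` is followed, within log-time `ε/(2Λ) + (L+1)`, by a closed interval `[a,b]` of log-length
`≥ ε/(2Λ)` on which `k ≤ κs − ε/2`.  (Either `k < κs − ε/2` on the initial stretch of log-length `ε/(2Λ)`, or the last visit to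
`{k ≥ κs − ε/2}` before the first sub-`(κs−ε)` time is followed by a first passage down to `κs − ε` INSIDE the zone, which the
descent bound makes log-long.) [folklore] -/
theorem exists_porous_interval_of_sojourn_of_descent
    {k : ℝ → ℝ} {T t₁ κs ε L Λ : ℝ} (hε : 0 < ε) (hL : 0 ≤ L) (hΛ : 0 < Λ)
    (hcont : ContinuousOn k (Set.Ico t₁ T))
    (hsoj : ∀ s t : ℝ, t₁ ≤ s → s ≤ t → t < T → (∀ τ ∈ Set.Icc s t, κs - ε ≤ k τ) →
      Real.log ((T - s) / (T - t)) ≤ L)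
    (hdesc : ∀ s t : ℝ, t₁ ≤ s → s ≤ t → t < T → (∀ τ ∈ Set.Icc s t, κs - ε ≤ k τ) →
      k s - k t ≤ Λ * Real.log ((T - s) / (T - t))) :
    ∀ s ∈ Set.Ico t₁ T, ∃ a b : ℝ, s ≤ a ∧ a ≤ b ∧ b < T ∧
      Real.log ((T - s) / (T - b)) ≤ ε / (2 * Λ) + (L + 1) ∧
      ε / (2 * Λ) ≤ Real.log ((T - a) / (T - b)) ∧ ∀ τ ∈ Set.Icc a b, k τ ≤ κs - ε / 2 := by
  intro s hs
  have hρ₀ : 0 < ε / (2 * Λ) := by positivity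
  have hTs : 0 < T - s := sub_pos.2 hs.2
  -- the two marks `s₁` (log-distance `ε/(2Λ)` after `s`) and `s₂` (log-distance `L+1` after `s₁`)
  obtain ⟨s₁, hs₁⟩ : ∃ s₁ : ℝ, s₁ = T - (T - s) * Real.exp (-(ε / (2 * Λ))) := ⟨_, rfl⟩
  obtain ⟨s₂, hs₂⟩ : ∃ s₂ : ℝ, s₂ = T - (T - s₁) * Real.exp (-(L + 1)) := ⟨_, rfl⟩
  have hTs₁ : T - s₁ = (T - s) * Real.exp (-(ε / (2 * Λ))) := by rw [hs₁]; ring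
  have hTs₂ : T - s₂ = (T - s₁) * Real.exp (-(L + 1)) := by rw [hs₂]; ring
  have hTs₁pos : 0 < T - s₁ := by rw [hTs₁]; positivity
  have hTs₂pos : 0 < T - s₂ := by rw [hTs₂]; positivity
  have hs₁T : s₁ < T := sub_pos.1 hTs₁pos
  have hs₂T : s₂ < T := sub_pos.1 hTs₂pos
  have hss₁ : s ≤ s₁ := by
    have h1 : Real.exp (-(ε / (2 * Λ))) ≤ 1 := Real.exp_le_one_iff.2 (by linarith)
    have h2 : (T - s) * Real.exp (-(ε / (2 * Λ))) ≤ (T - s) * 1 := mul_le_mul_of_nonneg_left h1 hTs.le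
    linarith [hTs₁]
  have hs₁s₂ : s₁ ≤ s₂ := by
    have h1 : Real.exp (-(L + 1)) ≤ 1 := Real.exp_le_one_iff.2 (by linarith)
    have h2 : (T - s₁) * Real.exp (-(L + 1)) ≤ (T - s₁) * 1 := mul_le_mul_of_nonneg_left h1 hTs₁pos.le
    linarith [hTs₂]
  have ht₁s : t₁ ≤ s := hs.1
  have hlog₁ : Real.log ((T - s) / (T - s₁)) = ε / (2 * Λ) := by
    rw [hTs₁, Real.exp_neg]
    have : (T - s) / ((T - s) * (Real.exp (ε / (2 * Λ)))⁻¹) = Real.exp (ε / (2 * Λ)) := by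
      field_simp
    rw [this, Real.log_exp]
  have hlog₂ : Real.log ((T - s₁) / (T - s₂)) = L + 1 := by
    rw [hTs₂, Real.exp_neg]
    have : (T - s₁) / ((T - s₁) * (Real.exp (L + 1))⁻¹) = Real.exp (L + 1) := by
      field_simp
    rw [this, Real.log_exp]
  have hlog₁₂ : Real.log ((T - s) / (T - s₂)) = ε / (2 * Λ) + (L + 1) := by
    have : (T - s) / (T - s₂) = ((T - s) / (T - s₁)) * ((T - s₁) / (T - s₂)) := by
      field_simp
    rw [this, Real.log_mul (div_pos hTs hTs₁pos).ne' (div_pos hTs₁pos hTs₂pos).ne', hlog₁, hlog₂]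
  -- Step 1: a sub-`(κs − ε)` time `τd ∈ [s₁, s₂]` (the window `[s₁,s₂]` has log-length `L+1 > L`)
  obtain ⟨τd, hτd, hkτd⟩ : ∃ τd ∈ Set.Icc s₁ s₂, k τd < κs - ε := by
    by_contra hcon
    push Not at hcon
    have h := hsoj s₁ s₂ (ht₁s.trans hss₁) hs₁s₂ hs₂T fun τ hτ => hcon τ hτ
    rw [hlog₂] at h
    linarith
  have hτdT : τd < T := lt_of_le_of_lt hτd.2 hs₂T
  have hsτd : s ≤ τd := hss₁.trans hτd.1
  have hcont_d : ContinuousOn k (Set.Icc s τd) :=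
    hcont.mono fun τ hτ => ⟨ht₁s.trans hτ.1, lt_of_le_of_lt hτ.2 hτdT⟩
  -- the last visits to the half-zone before `τd`
  set S : Set ℝ := Set.Icc s τd ∩ k ⁻¹' Set.Ici (κs - ε / 2) with hSdef
  by_cases hS : S.Nonempty
  swap
  · -- Case A: `k < κs − ε/2` on all of `[s, τd]`; the initial stretch `[s, s₁]` does it
    refine ⟨s, s₁, le_rfl, hss₁, hs₁T, ?_, ?_, fun τ hτ => ?_⟩
    · rw [hlog₁]; linarith
    · rw [hlog₁]
    · by_contra hcon
      push Not at hcon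
      exact hS ⟨τ, ⟨hτ.1, hτ.2.trans hτd.1⟩, hcon.le⟩
  -- Case B: `τu = max S` (last time in `[s,τd]` with `k ≥ κs − ε/2`), then the first passage `τm` down to `κs − ε`
  have hSclosed : IsClosed S := hcont_d.preimage_isClosed_of_isClosed isClosed_Icc isClosed_Ici
  have hSsub : S ⊆ Set.Icc s τd := Set.inter_subset_left
  have hSbdd : BddAbove S := bddAbove_Icc.mono hSsub
  have hScpt : IsCompact S := isCompact_Icc.of_isClosed_subset hSclosed hSsub
  set τu : ℝ := sSup S with hτudef
  have hτuS : τu ∈ S := hScpt.sSup_mem hS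
  have hτu_mem : τu ∈ Set.Icc s τd := hSsub hτuS
  have hkτu_ge : κs - ε / 2 ≤ k τu := hτuS.2
  have hτu_lt : τu < τd := by
    rcases eq_or_lt_of_le hτu_mem.2 with h | h
    · exfalso
      rw [h] at hkτu_ge
      linarith
    · exact h
  have hafter : ∀ τ ∈ Set.Ioc τu τd, k τ < κs - ε / 2 := by
    intro τ hτ
    by_contra hcon
    push Not at hcon
    have hτS : τ ∈ S := ⟨⟨hτu_mem.1.trans hτ.1.le, hτ.2⟩, hcon⟩
    have : τ ≤ τu := le_csSup hSbdd hτS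
    linarith [hτ.1]
  have hkτu_le : k τu ≤ κs - ε / 2 := by
    have hA : IsClosed (Set.Icc s τd ∩ k ⁻¹' Set.Iic (κs - ε / 2)) :=
      hcont_d.preimage_isClosed_of_isClosed isClosed_Icc isClosed_Iic
    have hsubA : Set.Ioc τu τd ⊆ Set.Icc s τd ∩ k ⁻¹' Set.Iic (κs - ε / 2) := fun τ hτ =>
      ⟨⟨hτu_mem.1.trans hτ.1.le, hτ.2⟩, (hafter τ hτ).le⟩
    have hcl : closure (Set.Ioc τu τd) ⊆ Set.Icc s τd ∩ k ⁻¹' Set.Iic (κs - ε / 2) :=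
      hA.closure_subset_iff.2 hsubA
    rw [closure_Ioc hτu_lt.ne] at hcl
    exact (hcl ⟨le_rfl, hτu_lt.le⟩).2
  -- first passage down to `κs − ε` after `τu`
  have hcont_u : ContinuousOn k (Set.Icc τu τd) :=
    hcont_d.mono fun τ hτ => ⟨hτu_mem.1.trans hτ.1, hτ.2⟩
  set S' : Set ℝ := Set.Icc τu τd ∩ k ⁻¹' Set.Iic (κs - ε) with hS'def
  have hS'closed : IsClosed S' := hcont_u.preimage_isClosed_of_isClosed isClosed_Icc isClosed_Iic
  have hS'sub : S' ⊆ Set.Icc τu τd := Set.inter_subset_left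
  have hS'bdd : BddBelow S' := bddBelow_Icc.mono hS'sub
  have hS'cpt : IsCompact S' := isCompact_Icc.of_isClosed_subset hS'closed hS'sub
  have hS'ne : S'.Nonempty := ⟨τd, ⟨hτu_lt.le, le_rfl⟩, hkτd.le⟩
  set τm : ℝ := sInf S' with hτmdef
  have hτmS' : τm ∈ S' := hS'cpt.sInf_mem hS'ne
  have hτm_mem : τm ∈ Set.Icc τu τd := hS'sub hτmS'
  have hkτm : k τm ≤ κs - ε := hτmS'.2
  have hτm_gt : τu < τm := by
    rcases eq_or_lt_of_le hτm_mem.1 with h | h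
    · exfalso
      rw [← h] at hkτm
      linarith
    · exact h
  have hτmT : τm < T := lt_of_le_of_lt hτm_mem.2 hτdT
  have hbefore : ∀ τ ∈ Set.Ico τu τm, κs - ε < k τ := by
    intro τ hτ
    by_contra hcon
    push Not at hcon
    have hτS' : τ ∈ S' := ⟨⟨hτ.1, hτ.2.le.trans hτm_mem.2⟩, hcon⟩
    have : τm ≤ τ := csInf_le hS'bdd hτS'
    linarith [hτ.2]
  have hzone : ∀ τ ∈ Set.Icc τu τm, κs - ε ≤ k τ := by
    have hA : IsClosed (Set.Icc τu τd ∩ k ⁻¹' Set.Ici (κs - ε)) :=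
      hcont_u.preimage_isClosed_of_isClosed isClosed_Icc isClosed_Ici
    have hsubA : Set.Ico τu τm ⊆ Set.Icc τu τd ∩ k ⁻¹' Set.Ici (κs - ε) := fun τ hτ =>
      ⟨⟨hτ.1, hτ.2.le.trans hτm_mem.2⟩, (hbefore τ hτ).le⟩
    have hcl : closure (Set.Ico τu τm) ⊆ Set.Icc τu τd ∩ k ⁻¹' Set.Ici (κs - ε) :=
      hA.closure_subset_iff.2 hsubA
    rw [closure_Ico hτm_gt.ne] at hcl
    exact fun τ hτ => (hcl hτ).2
  -- the descent bound on the zone interval `[τu, τm]` makes it log-long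
  have hdrop := hdesc τu τm (ht₁s.trans hτu_mem.1) hτm_gt.le hτmT hzone
  have hTτu : 0 < T - τu := by linarith [hτm_gt, hτmT]
  have hTτm : 0 < T - τm := sub_pos.2 hτmT
  have hlong : ε / (2 * Λ) ≤ Real.log ((T - τu) / (T - τm)) := by
    rw [div_le_iff₀ (by positivity : (0 : ℝ) < 2 * Λ)]
    nlinarith [hdrop, hkτu_ge, hkτm]
  refine ⟨τu, τm, hτu_mem.1, hτm_gt.le, hτmT, ?_, hlong, fun τ hτ => ?_⟩
  · -- `[s, τm] ⊂ [s, s₂]`, whose log-length is `ε/(2Λ) + (L+1)`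
    have hle : (T - s) / (T - τm) ≤ (T - s) / (T - s₂) :=
      div_le_div_of_nonneg_left hTs.le hTs₂pos (by linarith [hτm_mem.2, hτd.2])
    calc Real.log ((T - s) / (T - τm)) ≤ Real.log ((T - s) / (T - s₂)) :=
          Real.log_le_log (div_pos hTs hTτm) hle
      _ = ε / (2 * Λ) + (L + 1) := hlog₁₂
  · rcases eq_or_lt_of_le hτ.1 with h | h
    · rw [← h]; exact hkτu_le
    · exact (hafter τ ⟨h, hτ.2.trans hτm_mem.2⟩).le

/-! ## §2 The crux from uniform log-porosity alone (Z1\* → Z3 → Z4\*, BY NAME) -/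

/-- **The crux from UNIFORM LOG-POROSITY of the near-extremal time set** (repair R2 of the Z2 verdict, of record): if for every
violator flow and every minimal coefficient `k₀` there are `ε, ρ, W > 0` (`ρ ≤ W`) and an onset `t₁` such that every late time
`s` is followed within log-time `W` by a closed interval of log-length `≥ ρ` on which `k₀ ≤ κ⋆ − ε`, then
`NearExtremalTransiencePerFlow` holds.  Proof: the landed continuity Z3 (`stub_efficiencyContinuous`), `k₀ < κ⋆` on `(0,T)`
(`minimalCoeff_lt_sharp_of_pos`), the landed porosity calculus Z4\* (`logMean_le_of_porousZone`) and `κ⋆ ≤ κ` for every universal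
depletion constant (`sharpDepletion_le`). [folklore] -/
theorem nearExtremalTransiencePerFlow_of_porousZone
    (h : ∀ (C ν T : ℝ) (u : ℝ → EuclideanSpace ℝ (Fin 3) → EuclideanSpace ℝ (Fin 3))
      (p : ℝ → EuclideanSpace ℝ (Fin 3) → ℝ), IsViolator C ν T u p → ∀ k₀ : ℝ → ℝ, IsMinimalCoeff T u k₀ →
      ∃ ε ρ W : ℝ, 0 < ε ∧ 0 < ρ ∧ ρ ≤ W ∧ ∃ t₁ ∈ Set.Ico 0 T, ∀ s ∈ Set.Ico t₁ T,
        ∃ a b : ℝ, s ≤ a ∧ a ≤ b ∧ b < T ∧ Real.log ((T - s) / (T - b)) ≤ W ∧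
          ρ ≤ Real.log ((T - a) / (T - b)) ∧ ∀ τ ∈ Set.Icc a b, k₀ τ ≤ kStar - ε) :
    NearExtremalTransiencePerFlow := by
  intro C ν T hC hν hT u p hsol hLH hdec hrate hne
  by_contra hno
  have hV : IsViolator C ν T u p := ⟨hC, hν, hT, hsol, hLH, hdec, hrate, hne, hno⟩
  obtain ⟨k₀, hk₀m, hk₀01, hcl, hmin⟩ := DepletionLadder.exists_canonical_coefficient hν hT hsol hLH hdec
  have hK : IsMinimalCoeff T u k₀ := ⟨hk₀m, hk₀01, hcl, hmin⟩
  obtain ⟨ε, ρ, W, hε, hρ, hρW, t₁, ht₁, hpor⟩ := h C ν T u p hV k₀ hK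
  have hcont : ContinuousOn k₀ (Set.Ioo 0 T) := stub_efficiencyContinuous C ν T u p hV k₀ hK
  have hlt := DepletionLadder.minimalCoeff_lt_sharp_of_pos hν hT hsol hLH hdec hmin
  -- onset `t₃ = max t₁ (T/2)`
  set t₃ : ℝ := max t₁ (T / 2) with ht₃def
  have ht₃T : t₃ < T := max_lt ht₁.2 (by linarith)
  have ht₃0 : 0 < t₃ := lt_of_lt_of_le (by linarith) (le_max_right _ _)
  have ht₁3 : t₁ ≤ t₃ := le_max_left _ _
  have hks : ∀ τ ∈ Set.Ico t₃ T, k₀ τ ≤ kStar := by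
    intro τ hτ
    have h := (hlt τ ⟨ht₃0.trans_le hτ.1, hτ.2⟩).le
    unfold kStar udcSet
    exact h
  have hcont₃ : ContinuousOn k₀ (Set.Ico t₃ T) := hcont.mono fun τ hτ => ⟨ht₃0.trans_le hτ.1, hτ.2⟩
  have hpor₃ : ∀ s ∈ Set.Ico t₃ T, ∃ a b : ℝ, s ≤ a ∧ a ≤ b ∧ b < T ∧ Real.log ((T - s) / (T - b)) ≤ W ∧
      ρ ≤ Real.log ((T - a) / (T - b)) ∧ ∀ τ ∈ Set.Icc a b, k₀ τ ≤ kStar - ε :=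
    fun s hs => hpor s ⟨ht₁3.trans hs.1, hs.2⟩
  obtain ⟨θ₀, B, hθ₀0, hθ₀1, hmean⟩ :=
    logMean_le_of_porousZone k₀ T t₃ kStar ε ρ W kStar_pos hε hρ hρW ht₃T (fun τ => (hk₀01 τ).1) hks hcont₃ hpor₃
  apply hno
  refine ⟨θ₀, hθ₀0, hθ₀1, fun κ hκ => ?_⟩
  have hκs : kStar ≤ κ := by
    unfold kStar udcSet
    exact DepletionLadder.sharpDepletion_le hκ
  refine ⟨t₃, ⟨ht₃0.le, ht₃T⟩, k₀, B, hk₀m, hk₀01,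
    fun t ht M hM => hcl t ⟨ht₃0.le.trans ht.1, ht.2⟩ M hM, fun t ht => ?_⟩
  have hlog : 0 ≤ Real.log ((T - t₃) / (T - t)) :=
    Real.log_nonneg ((one_le_div (sub_pos.2 ht.2)).2 (by linarith [ht.1]))
  have h0 : 0 ≤ θ₀ * kStar := mul_nonneg hθ₀0 kStar_pos.le
  have hmono : (θ₀ * kStar) ^ 2 ≤ (θ₀ * κ) ^ 2 :=
    pow_le_pow_left₀ h0 (mul_le_mul_of_nonneg_left hκs hθ₀0) 2
  calc ∫ τ in t₃..t, k₀ τ ^ 2 / (T - τ) ≤ (θ₀ * kStar) ^ 2 * Real.log ((T - t₃) / (T - t)) + B := hmean t ht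
    _ ≤ (θ₀ * κ) ^ 2 * Real.log ((T - t₃) / (T - t)) + B := by nlinarith [hmono, hlog]

/-! ## §3 Sojourn bound + one-sided descent bound ⇒ porosity ⇒ crux -/

/-- **Z1 ∧ Z2⁻ ⇒ Z1\***: the registered sojourn bound Z1 and the ONE-SIDED DESCENT half of Z2 (on zone windows
`k₀ s − k₀ t ≤ Λ·log((T−s)/(T−t))`) give uniform log-porosity of the near-extremal time set, with the landed continuity Z3.
(Common zone width `min ε₁ ε₂`, onset `max t₁ t₂ (T/2)`, then `exists_porous_interval_of_sojourn_of_descent`.) [folklore] -/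
theorem porousZone_of_sojournBound_of_zoneDescent
    (h1 : ∀ (C ν T : ℝ) (u : ℝ → EuclideanSpace ℝ (Fin 3) → EuclideanSpace ℝ (Fin 3))
      (p : ℝ → EuclideanSpace ℝ (Fin 3) → ℝ), IsViolator C ν T u p → ∀ k₀ : ℝ → ℝ, IsMinimalCoeff T u k₀ →
      ∃ ε L : ℝ, 0 < ε ∧ 0 ≤ L ∧ ∃ t₁ ∈ Set.Ico 0 T, ∀ s t : ℝ, t₁ ≤ s → s ≤ t → t < T →
        (∀ τ ∈ Set.Icc s t, kStar - ε ≤ k₀ τ) → Real.log ((T - s) / (T - t)) ≤ L)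
    (h2 : ∀ (C ν T : ℝ) (u : ℝ → EuclideanSpace ℝ (Fin 3) → EuclideanSpace ℝ (Fin 3))
      (p : ℝ → EuclideanSpace ℝ (Fin 3) → ℝ), IsViolator C ν T u p → ∀ k₀ : ℝ → ℝ, IsMinimalCoeff T u k₀ →
      ∃ ε Λ : ℝ, 0 < ε ∧ 0 < Λ ∧ ∃ t₁ ∈ Set.Ico 0 T, ∀ s t : ℝ, t₁ ≤ s → s ≤ t → t < T →
        (∀ τ ∈ Set.Icc s t, kStar - ε ≤ k₀ τ) → k₀ s - k₀ t ≤ Λ * Real.log ((T - s) / (T - t))) :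
    ∀ (C ν T : ℝ) (u : ℝ → EuclideanSpace ℝ (Fin 3) → EuclideanSpace ℝ (Fin 3))
      (p : ℝ → EuclideanSpace ℝ (Fin 3) → ℝ), IsViolator C ν T u p → ∀ k₀ : ℝ → ℝ, IsMinimalCoeff T u k₀ →
      ∃ ε ρ W : ℝ, 0 < ε ∧ 0 < ρ ∧ ρ ≤ W ∧ ∃ t₁ ∈ Set.Ico 0 T, ∀ s ∈ Set.Ico t₁ T,
        ∃ a b : ℝ, s ≤ a ∧ a ≤ b ∧ b < T ∧ Real.log ((T - s) / (T - b)) ≤ W ∧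
          ρ ≤ Real.log ((T - a) / (T - b)) ∧ ∀ τ ∈ Set.Icc a b, k₀ τ ≤ kStar - ε := by
  intro C ν T u p hV k₀ hK
  have hT : 0 < T := hV.2.2.1
  obtain ⟨ε₁, L, hε₁, hL, t₁, ht₁, hsoj⟩ := h1 C ν T u p hV k₀ hK
  obtain ⟨ε₂, Λ, hε₂, hΛ, t₂, ht₂, hdesc⟩ := h2 C ν T u p hV k₀ hK
  have hcont : ContinuousOn k₀ (Set.Ioo 0 T) := stub_efficiencyContinuous C ν T u p hV k₀ hK
  set ε : ℝ := min ε₁ ε₂ with hεdef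
  have hε : 0 < ε := lt_min hε₁ hε₂
  have hεle₁ : ε ≤ ε₁ := min_le_left _ _
  have hεle₂ : ε ≤ ε₂ := min_le_right _ _
  set t₃ : ℝ := max (max t₁ t₂) (T / 2) with ht₃def
  have ht₃T : t₃ < T := max_lt (max_lt ht₁.2 ht₂.2) (by linarith)
  have ht₃0 : 0 < t₃ := lt_of_lt_of_le (by linarith) (le_max_right _ _)
  have ht₁3 : t₁ ≤ t₃ := (le_max_left _ _).trans (le_max_left _ _)
  have ht₂3 : t₂ ≤ t₃ := (le_max_right _ _).trans (le_max_left _ _)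
  have hcont₃ : ContinuousOn k₀ (Set.Ico t₃ T) := hcont.mono fun τ hτ => ⟨ht₃0.trans_le hτ.1, hτ.2⟩
  have hsoj₃ : ∀ s t : ℝ, t₃ ≤ s → s ≤ t → t < T → (∀ τ ∈ Set.Icc s t, kStar - ε ≤ k₀ τ) →
      Real.log ((T - s) / (T - t)) ≤ L := fun s t hs hst htT hz =>
    hsoj s t (ht₁3.trans hs) hst htT fun τ hτ => by linarith [hz τ hτ]
  have hdesc₃ : ∀ s t : ℝ, t₃ ≤ s → s ≤ t → t < T → (∀ τ ∈ Set.Icc s t, kStar - ε ≤ k₀ τ) →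
      k₀ s - k₀ t ≤ Λ * Real.log ((T - s) / (T - t)) := fun s t hs hst htT hz =>
    hdesc s t (ht₂3.trans hs) hst htT fun τ hτ => by linarith [hz τ hτ]
  have hmain := exists_porous_interval_of_sojourn_of_descent (κs := kStar) hε hL hΛ hcont₃ hsoj₃ hdesc₃
  refine ⟨ε / 2, ε / (2 * Λ), ε / (2 * Λ) + (L + 1), by positivity, by positivity, by linarith,
    t₃, ⟨ht₃0.le, ht₃T⟩, fun s hs => ?_⟩
  obtain ⟨a, b, hsa, hab, hbT, hW, hρ, hk⟩ := hmain s hs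
  exact ⟨a, b, hsa, hab, hbT, hW, hρ, hk⟩

/-- **Z1 ∧ Z2⁻ ⇒ crux**: the sojourn bound (registered Z1) and the one-sided DESCENT half of the registered Z2 already give
`NearExtremalTransiencePerFlow` (Z3, Z4\* landed).  The descent half is the one that does NOT involve the palinstrophy
dissipation number `Π`. [folklore] -/
theorem nearExtremalTransiencePerFlow_of_sojournBound_of_zoneDescent
    (h1 : ∀ (C ν T : ℝ) (u : ℝ → EuclideanSpace ℝ (Fin 3) → EuclideanSpace ℝ (Fin 3))
      (p : ℝ → EuclideanSpace ℝ (Fin 3) → ℝ), IsViolator C ν T u p → ∀ k₀ : ℝ → ℝ, IsMinimalCoeff T u k₀ →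
      ∃ ε L : ℝ, 0 < ε ∧ 0 ≤ L ∧ ∃ t₁ ∈ Set.Ico 0 T, ∀ s t : ℝ, t₁ ≤ s → s ≤ t → t < T →
        (∀ τ ∈ Set.Icc s t, kStar - ε ≤ k₀ τ) → Real.log ((T - s) / (T - t)) ≤ L)
    (h2 : ∀ (C ν T : ℝ) (u : ℝ → EuclideanSpace ℝ (Fin 3) → EuclideanSpace ℝ (Fin 3))
      (p : ℝ → EuclideanSpace ℝ (Fin 3) → ℝ), IsViolator C ν T u p → ∀ k₀ : ℝ → ℝ, IsMinimalCoeff T u k₀ →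
      ∃ ε Λ : ℝ, 0 < ε ∧ 0 < Λ ∧ ∃ t₁ ∈ Set.Ico 0 T, ∀ s t : ℝ, t₁ ≤ s → s ≤ t → t < T →
        (∀ τ ∈ Set.Icc s t, kStar - ε ≤ k₀ τ) → k₀ s - k₀ t ≤ Λ * Real.log ((T - s) / (T - t))) :
    NearExtremalTransiencePerFlow :=
  nearExtremalTransiencePerFlow_of_porousZone (porousZone_of_sojournBound_of_zoneDescent h1 h2)

/-- **Z1 ∧ Z2 ⇒ crux** (the registered line `zone_transversality` with Z3 and Z4 discharged, as a tree theorem): the registered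
two-sided zone log-Lipschitz bound trivially contains its descent half. [folklore] -/
theorem nearExtremalTransiencePerFlow_of_sojournBound_of_zoneLipschitz
    (h1 : ∀ (C ν T : ℝ) (u : ℝ → EuclideanSpace ℝ (Fin 3) → EuclideanSpace ℝ (Fin 3))
      (p : ℝ → EuclideanSpace ℝ (Fin 3) → ℝ), IsViolator C ν T u p → ∀ k₀ : ℝ → ℝ, IsMinimalCoeff T u k₀ →
      ∃ ε L : ℝ, 0 < ε ∧ 0 ≤ L ∧ ∃ t₁ ∈ Set.Ico 0 T, ∀ s t : ℝ, t₁ ≤ s → s ≤ t → t < T →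
        (∀ τ ∈ Set.Icc s t, kStar - ε ≤ k₀ τ) → Real.log ((T - s) / (T - t)) ≤ L)
    (h2 : ∀ (C ν T : ℝ) (u : ℝ → EuclideanSpace ℝ (Fin 3) → EuclideanSpace ℝ (Fin 3))
      (p : ℝ → EuclideanSpace ℝ (Fin 3) → ℝ), IsViolator C ν T u p → ∀ k₀ : ℝ → ℝ, IsMinimalCoeff T u k₀ →
      ∃ ε Λ : ℝ, 0 < ε ∧ 0 < Λ ∧ ∃ t₁ ∈ Set.Ico 0 T, ∀ s t : ℝ, t₁ ≤ s → s ≤ t → t < T →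
        (∀ τ ∈ Set.Icc s t, kStar - ε ≤ k₀ τ) → |k₀ t - k₀ s| ≤ Λ * Real.log ((T - s) / (T - t))) :
    NearExtremalTransiencePerFlow := by
  refine nearExtremalTransiencePerFlow_of_sojournBound_of_zoneDescent h1 fun C ν T u p hV k₀ hK => ?_
  obtain ⟨ε, Λ, hε, hΛ, t₁, ht₁, h⟩ := h2 C ν T u p hV k₀ hK
  refine ⟨ε, Λ, hε, hΛ, t₁, ht₁, fun s t hs hst htT hz => ?_⟩
  have habs := h s t hs hst htT hz
  rw [abs_sub_comm] at habs
  exact (le_abs_self _).trans habs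

end Summit.NavierStokesRegularity.NavierStokesRegularity.Theorems.NearExtremalTransiencePerFlow.ZoneTransversality

end
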